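import Summits.RiemannHypothesis.RiemannHypothesis.Theorems.WeilFormatCFarAssembly
import HarnessLib

/-!
# Format C: positivity of the far diagonal `d̂^±` on all far modes from ONE value (hypothesis `hd` of the soundness theorem)

Route context: Fourier–Galerkin / Schur-complement certificates of Weil positivity on a window ("format C";
cell memo `run/shared/lean/pub/rh-explicit/rh-explicit-weil-10/FORMATC-DESIGN.md` §4.10 / §9.1–9.3; supporting
stmt-RiemannHypothesis-0098; seat rh-explicit-weil-10).  `WeilFormatC.sum_range_mul_mul_nonneg_of_certificate` needs
`0 < d̂_m` for EVERY far mode `m ≥ B`; the closed-form diagonals of `WeilFormatCFarAssembly.lean` make this a single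
numeric check per rung:

* `even_dhat_core_mono` — the `m`-dependent part of `d̂⁺`, `½(Re ψ(¼+iω_m/2) − log π) − a(1+E)/(π²m²) − 1/(8m)`, is
  non-decreasing in `m ≥ 1` (`reDigammaQuarter_mono` = Yoshida's (D3), p. 303); hence
  `even_dhat_pos_of_pos_at` — `0 < d̂⁺(B) ⟹ ∀ m ≥ B, 0 < d̂⁺(m)`;
* `odd_dhat_atan_core_mono` / `odd_dhat_atan_pos_of_pos_at` — for the arctan-weight odd diagonal
  (`gramCoeff_odd_far_ge_diag_atan`) the Hilbert penalty is bounded, `½(π/2 − arctan(√B/√(k+1))) ≤ π/4`, so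
  `0 < core(B) − π/4 − (constants) ⟹ ∀ k ≥ B, 0 < d̂⁻(k)`.

The value `d̂(B)` itself is a rung datum (an enclosure of `Re ψ(¼ + iπB/(2a))` via weil-2's `MC.digammaBox` /
`reDigammaQuarter` series bounds).  Elementary; standard axioms; no definitions; no RH claim.
-/

set_option autoImplicit false
-- `Summit.RiemannHypothesis.RiemannHypothesis.…` is the layout-mandated namespace (summit = problem name).
set_option linter.dupNamespace false

noncomputable section

open Complex Finset
open scoped Real BigOperators ArithmeticFunction.vonMangoldt

namespace Summit.RiemannHypothesis.RiemannHypothesis.Theorems.WeilFormatC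

open Literature.NumberTheory.LFunctions Literature.NumberTheory.LFunctions.Yoshida1992
open Literature.Analysis.SpecialFunctions

variable {a : ℝ}

/-- `Re ψ(¼ + iω_m/2)` is non-decreasing along the frequencies `ω_m = πm/a`, `m : ℕ` (`a > 0`). -/
theorem reDigammaQuarter_freq_mono (ha : 0 < a) {B m : ℕ} (hBm : B ≤ m) :
    reDigammaQuarter (freq a B) ≤ reDigammaQuarter (freq a m) := by
  refine reDigammaQuarter_mono ?_
  rw [freq_natCast, freq_natCast, abs_of_nonneg (by positivity), abs_of_nonneg (by positivity)]
  have : (B : ℝ) ≤ m := by exact_mod_cast hBm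
  exact div_le_div_of_nonneg_right (mul_le_mul_of_nonneg_left this Real.pi_pos.le) ha.le

/-- **Even diagonal, monotone core.**  For `1 ≤ B ≤ m` and `C ≥ 0`:
`½(Re ψ(¼+iω_B/2) − log π) − C/B² − 1/(8B) ≤ ½(Re ψ(¼+iω_m/2) − log π) − C/m² − 1/(8m)`. -/
theorem even_dhat_core_mono (ha : 0 < a) {C : ℝ} (hC : 0 ≤ C) {B m : ℕ} (hB : 1 ≤ B) (hBm : B ≤ m) :
    (reDigammaQuarter (freq a B) - Real.log π) / 2 - C / (π ^ 2 * B ^ 2) - 1 / (8 * B)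
      ≤ (reDigammaQuarter (freq a m) - Real.log π) / 2 - C / (π ^ 2 * m ^ 2) - 1 / (8 * m) := by
  have h1 := reDigammaQuarter_freq_mono ha hBm
  have hB0 : (0 : ℝ) < B := by exact_mod_cast hB
  have hBm' : (B : ℝ) ≤ m := by exact_mod_cast hBm
  have hm0 : (0 : ℝ) < m := lt_of_lt_of_le hB0 hBm'
  have h2 : C / (π ^ 2 * m ^ 2) ≤ C / (π ^ 2 * B ^ 2) := by
    refine div_le_div_of_nonneg_left hC (by positivity) ?_
    exact mul_le_mul_of_nonneg_left (pow_le_pow_left₀ hB0.le hBm' 2) (by positivity)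
  have h3 : 1 / (8 * (m : ℝ)) ≤ 1 / (8 * B) :=
    one_div_le_one_div_of_le (by positivity) (by linarith)
  linarith

/-- **`hd` for the even sector from one value.**  With `d̂⁺` the far diagonal of `gramCoeff_even_far_ge_diag`
(`2 ≤ B`): if `0 < d̂⁺(B)` then `0 < d̂⁺(m)` for every `m ≥ B`. -/
theorem even_dhat_pos_of_pos_at (ha : 0 < a) {B : ℕ} (hB : 2 ≤ B)
    (h0 : 0 < (reDigammaQuarter (freq a B) - Real.log π) / 2
        - a * (1 + weilArchDensity (2 * a)) / (π ^ 2 * B ^ 2)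
        - 1 / (8 * B) - a * (1 + weilArchDensity (2 * a)) / π ^ 2 * Real.sqrt (8 / ((B - 1 : ℕ) : ℝ))
        - (∑ k ∈ weilPrimeIndex a, (Λ k : ℝ) / Real.sqrt k * (2 * Real.cos (π / (⌊2 * a / Real.log k⌋₊ + 2)))) / 2)
    (m : ℕ) (hm : B ≤ m) :
    0 < (reDigammaQuarter (freq a m) - Real.log π) / 2
        - a * (1 + weilArchDensity (2 * a)) / (π ^ 2 * m ^ 2)
        - 1 / (8 * m) - a * (1 + weilArchDensity (2 * a)) / π ^ 2 * Real.sqrt (8 / ((B - 1 : ℕ) : ℝ))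
        - (∑ k ∈ weilPrimeIndex a, (Λ k : ℝ) / Real.sqrt k * (2 * Real.cos (π / (⌊2 * a / Real.log k⌋₊ + 2)))) / 2 := by
  have hE : 0 < weilArchDensity (2 * a) := weilArchDensity_pos (by positivity)
  have hC : 0 ≤ a * (1 + weilArchDensity (2 * a)) := by positivity
  have h := even_dhat_core_mono ha hC (le_trans (by norm_num) hB) hm
  linarith

/-- **Odd diagonal (arctan weights), monotone core.**  For `1 ≤ B`, `B ≤ k` (so modes `B+1 ≤ k+1`) and `C ≥ 0`:
the core `½(Re ψ(¼+iω_{k+1}/2) − log π) − 1/(8(k+1)) − C/(π²(k+1)²)` at `k` dominates its value at `B`. -/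
theorem odd_dhat_core_mono (ha : 0 < a) {C : ℝ} (hC : 0 ≤ C) {B k : ℕ} (hBk : B ≤ k) :
    (reDigammaQuarter (freq a ((B : ℤ) + 1)) - Real.log π) / 2 - 1 / (8 * ((B : ℝ) + 1))
        - C / (π ^ 2 * ((B : ℝ) + 1) ^ 2)
      ≤ (reDigammaQuarter (freq a ((k : ℤ) + 1)) - Real.log π) / 2 - 1 / (8 * ((k : ℝ) + 1))
        - C / (π ^ 2 * ((k : ℝ) + 1) ^ 2) := by
  have e1 : ((B : ℤ) + 1) = ((B + 1 : ℕ) : ℤ) := by push_cast; ring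
  have e2 : ((k : ℤ) + 1) = ((k + 1 : ℕ) : ℤ) := by push_cast; ring
  rw [e1, e2]
  have h1 := reDigammaQuarter_freq_mono ha (B := B + 1) (m := k + 1) (by omega)
  have hB0 : (0 : ℝ) < (B : ℝ) + 1 := by positivity
  have hBk' : (B : ℝ) + 1 ≤ (k : ℝ) + 1 := by
    have : (B : ℝ) ≤ k := by exact_mod_cast hBk
    linarith
  have h2 : C / (π ^ 2 * ((k : ℝ) + 1) ^ 2) ≤ C / (π ^ 2 * ((B : ℝ) + 1) ^ 2) := by
    refine div_le_div_of_nonneg_left hC (by positivity) ?_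
    exact mul_le_mul_of_nonneg_left (pow_le_pow_left₀ hB0.le hBk' 2) (by positivity)
  have h3 : 1 / (8 * ((k : ℝ) + 1)) ≤ 1 / (8 * ((B : ℝ) + 1)) :=
    one_div_le_one_div_of_le (by positivity) (by linarith)
  linarith

/-- The arctan Hilbert penalty is bounded: `0 ≤ ½(π/2 − arctan(√B/√(k+1))) ≤ π/4`. -/
theorem hilbert_atan_penalty_le (B k : ℕ) :
    (π / 2 - Real.arctan (Real.sqrt B / Real.sqrt ((k : ℝ) + 1))) / 2 ≤ π / 4 := by
  have h : 0 ≤ Real.arctan (Real.sqrt B / Real.sqrt ((k : ℝ) + 1)) := by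
    rw [← Real.arctan_zero]
    exact Real.arctan_strictMono.monotone (by positivity)
  linarith

/-- **`hd` for the odd sector (arctan weights) from one value.**  With `d̂⁻` the far diagonal of
`gramCoeff_odd_far_ge_diag_atan` (`1 ≤ B`): if the monotone core at `k = B` exceeds `π/4` plus the constants, i.e.
`0 < ½(Re ψ(¼+iω_{B+1}/2) − log π) − 1/(8(B+1)) − a(1+E)/(π²(B+1)²) − π/4 − c_R√(8/B) − A_op⁺/2 − s²a/(π²B)`,
then `0 < d̂⁻(k)` for every `k ≥ B`. -/
theorem odd_dhat_atan_pos_of_pos_at (ha : 0 < a) {B : ℕ}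
    (h0 : 0 < (reDigammaQuarter (freq a ((B : ℤ) + 1)) - Real.log π) / 2 - 1 / (8 * ((B : ℝ) + 1))
        - a * (1 + weilArchDensity (2 * a)) / (π ^ 2 * ((B : ℝ) + 1) ^ 2) - π / 4
        - a * (1 + weilArchDensity (2 * a)) / π ^ 2 * Real.sqrt (8 / B)
        - (∑ k ∈ weilPrimeIndex a, (Λ k : ℝ) / Real.sqrt k * (2 * Real.cos (π / (⌊2 * a / Real.log k⌋₊ + 2)))) / 2
        - (Real.exp (a / 2) - Real.exp (-(a / 2))) ^ 2 * a / (π ^ 2 * B))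
    (k : ℕ) (hk : B ≤ k) :
    0 < (reDigammaQuarter (freq a ((k : ℤ) + 1)) - Real.log π) / 2 - 1 / (8 * ((k : ℝ) + 1))
        - a * (1 + weilArchDensity (2 * a)) / (π ^ 2 * ((k : ℝ) + 1) ^ 2)
        - (π / 2 - Real.arctan (Real.sqrt B / Real.sqrt ((k : ℝ) + 1))) / 2
        - a * (1 + weilArchDensity (2 * a)) / π ^ 2 * Real.sqrt (8 / B)
        - (∑ k ∈ weilPrimeIndex a, (Λ k : ℝ) / Real.sqrt k * (2 * Real.cos (π / (⌊2 * a / Real.log k⌋₊ + 2)))) / 2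
        - (Real.exp (a / 2) - Real.exp (-(a / 2))) ^ 2 * a / (π ^ 2 * B) := by
  have hE : 0 < weilArchDensity (2 * a) := weilArchDensity_pos (by positivity)
  have hC : 0 ≤ a * (1 + weilArchDensity (2 * a)) := by positivity
  have h := odd_dhat_core_mono ha hC hk
  have hpen := hilbert_atan_penalty_le B k
  linarith

end Summit.RiemannHypothesis.RiemannHypothesis.Theorems.WeilFormatC

end
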